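import Mathlib
import HarnessLib
import Summits.CriticalPhenomena.PercolationContinuityZ3.Theses.PercTreeValue
import Summits.CriticalPhenomena.PercolationContinuityZ3.Theorems.PercTreeValueTetrahedronDisjointCoexistenceStubPairSymm
import Summits.CriticalPhenomena.PercolationContinuityZ3.Theorems.PercTreeValueTetrahedronDisjointCoexistenceStubShellDecoupling
import Summits.CriticalPhenomena.PercolationContinuityZ3.Theorems.PercTreeValueTetrahedronDisjointCoexistenceStubMirrorRestrict
import Summits.CriticalPhenomena.PercolationContinuityZ3.Theorems.PercTreeValueTetrahedronDisjointCoexistenceStubTiledShell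
import Summits.CriticalPhenomena.PercolationContinuityZ3.Theorems.PercTreeValueAssemblyViaDisjointCoexistence
import Literature.Probability.Percolation.TwoPointFunction
import Literature.Probability.Percolation.TreeGraphBound
import Literature.Probability.Percolation.RSW
import Literature.Probability.LatticeModels.ThermodynamicLimit

/-!
# Route PercTreeValue — transfer D for the crux `TetrahedronDisjointCoexistence` (stmt-CriticalPhenomena-7798):
# tiled closed shell — X_B ∧ box restriction ⇒ the crux (line `Sketch`, rev c2)

Line `Sketch` (rev c2, lead prover-line-stmt-CriticalPhenomena-7798-c2-0/c3-0; card `closed-shell-barrier-dichotomy`,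
reshaped to a TILED thin shell). With `a_r = (r,r,0)`, `b_r = (r,0,r)`, `c_r = (0,r,r)`, `k = ⌊r/8⌋ ≥ 8` (`r ≥ 64`),
`s = ⌊r/16⌋ − 1`, mesh `g = 2s + 1`, margin `m = 2k − 1`:

* `R := Box_r = [−r, 2r]² × [−2r, 3k]` ∋ `0, a_r` (both `3k` below the roof, `≥ r` from the other faces),
  `R' := Box_r + B(m)` (roof `5k − 1`), `W := {x | r − 3k ≤ x₂}` ∋ `b_r, c_r` (so `φ_r W = {x₂ ≤ 3k} ⊇ R` for the
  rotoreflection `φ_r(x) = (r − x₁, x₀, r − x₂)`), tiles centred at `anchor + g • j`, `j ∈ B(25)` (`≤ 51³` tiles),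
  `anchor = (4k, 4k, −8k)`; `Shell(R,R')` := no open path of `R' ∖ R` from a vertex adjacent to `R` to a vertex adjacent
  to `R'ᶜ`.
* `stub_cruxOfTiledShell` (registered transfer stub T2 of `Cruxes/TetrahedronDisjointCoexistence/Lines/Sketch.lean`):
  the HYPOTHESES are X_B = `PercAnnulusCrossing.CritAnnulusNonCrossing` (stmt-CriticalPhenomena-0846, verbatim: at `p_c`, with
  probability `≥ c_X` no open path inside `B(2n)` joins `B(n)` to `∂B(2n)`) and BOX RESTRICTION
  (`P(0 ↔ a_r inside Box_r) ≥ c τ(0,a_r)`); the CONCLUSION is the crux formula with `δ = c_X ^ (51³) · c²`, `r₀ ↦ max r₀ 64`: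
  `P(0 ↔_{R} a_r) · P(Shell(R, R')) · P(b_r ↔_{W} c_r) ≤ P(target)` (landed `stub_shellDecoupling`),
  `P(Shell(R, R')) ≥ c_X ^ |J| ≥ c_X ^ (51³)` from the grid `J` of translated aspect-2 X_B annuli glued by Harris–FKG
  (landed `stub_tiledShell`; its cover hypothesis is integer-division bookkeeping for the tile index
  `q_i = ⌊(u_i − anchor_i + s)/g⌋`, closed by `omega`), `P(b_r ↔_{W} c_r) = P(0 ↔_{x₂ ≤ 3k} a_r) ≥ P(0 ↔_{Box_r} a_r) ≥ c τ(0,a_r)` (landed `stub_mirrorRestrict`,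
  `openConnIn_mono`), `τ(b_r,c_r) = τ(0,a_r)` (landed `stub_pairSymm`).
* `tetrahedronDisjointCoexistence_of_annulusNonCrossing_of_boxRestriction` — the same, concluded BY NAME.
* `percolationContinuityZ3_of_annulusNonCrossing_of_boxRestriction` — composed with `AssemblyViaDisjointCoexistence_proof`:
  formal record that the pair is continuity-strength (X_B alone already is, via route `PercAnnulusCrossing`).

No new definitions; hypotheses are spelled out over tree declarations exactly as the registered open stubs
`stub_annulusNonCrossing`, `stub_boxRestriction` of `Lines/Sketch.lean`.
-/

noncomputable section

namespace Summit.CriticalPhenomena.PercolationContinuityZ3.Theorems.TetrahedronDisjointCoexistence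

open MeasureTheory
open Literature.Probability.Percolation Literature.Probability.LatticeModels

/-- **Transfer D (registered stub T2 of line `Sketch`, rev c2).** X_B (`PercAnnulusCrossing.CritAnnulusNonCrossing`,
verbatim) and BOX restriction (`P(0 ↔ a_r inside [−r,2r]² × [−2r, 3⌊r/8⌋]) ≥ c τ(0,a_r)`), glued by the tiled closed shell
(`stub_tiledShell`), the decoupling `stub_shellDecoupling`, the mirror `stub_mirrorRestrict` and `stub_pairSymm`, give the
crux `TetrahedronDisjointCoexistence` — stated as its formula, unfolded — with `δ = c_X ^ (51³) · c²`, `r₀ ↦ max r₀ 64`. -/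
theorem stub_cruxOfTiledShell
    (hXB : ∃ c : ℝ, 0 < c ∧ ∀ n : ℕ, 1 ≤ n →
      (bondPercolation (zdGraph 3) (criticalProbI 3)).real
          {ω | ∃ x ∈ box 3 n, ∃ y ∈ innerBoundary (zdGraph 3) (box 3 (2 * n)),
            ω ∈ openConnIn ↑(box 3 (2 * n)) x y} ≤ 1 - c)
    (hBox : ∃ c : ℝ, 0 < c ∧ ∃ r₀ : ℕ, ∀ r : ℕ, r₀ ≤ r →
      c * tau 3 (criticalProbI 3) 0 ![(r : ℤ), (r : ℤ), 0] ≤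
        (bondPercolation (zdGraph 3) (criticalProbI 3)).real
          (openConnIn
            {x : Site 3 | -(r : ℤ) ≤ x 0 ∧ x 0 ≤ 2 * (r : ℤ) ∧ -(r : ℤ) ≤ x 1 ∧ x 1 ≤ 2 * (r : ℤ) ∧
              -(2 * (r : ℤ)) ≤ x 2 ∧ x 2 ≤ 3 * ((r : ℤ) / 8)}
            (0 : Site 3) ![(r : ℤ), (r : ℤ), 0])) :
    ∃ δ : ℝ, 0 < δ ∧ ∃ r₀ : ℕ, ∀ r : ℕ, r₀ ≤ r →
      δ * tau 3 (criticalProbI 3) 0 ![(r : ℤ), (r : ℤ), 0] *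
          tau 3 (criticalProbI 3) ![(r : ℤ), 0, (r : ℤ)] ![0, (r : ℤ), (r : ℤ)] ≤
        (bondPercolation (zdGraph 3) (criticalProbI 3)).real
          (openConn 0 ![(r : ℤ), (r : ℤ), 0] ∩ openConn ![(r : ℤ), 0, (r : ℤ)] ![0, (r : ℤ), (r : ℤ)] ∩
            (openConn (0 : Site 3) ![(r : ℤ), 0, (r : ℤ)])ᶜ) := by
  obtain ⟨cX, hcX, hX⟩ := hXB
  obtain ⟨c, hc, r₁, hC⟩ := hBox
  have hcX1 : cX ≤ 1 := by
    have h := hX 1 le_rfl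
    have h0 : 0 ≤ (bondPercolation (zdGraph 3) (criticalProbI 3)).real
        {ω | ∃ x ∈ box 3 1, ∃ y ∈ innerBoundary (zdGraph 3) (box 3 (2 * 1)),
          ω ∈ openConnIn ↑(box 3 (2 * 1)) x y} := measureReal_nonneg
    linarith
  refine ⟨cX ^ (51 ^ 3) * c ^ 2, by positivity, max r₁ 64, fun r hr => ?_⟩
  have hr₁ : r₁ ≤ r := le_trans (le_max_left _ _) hr
  have hr64 : 64 ≤ r := le_trans (le_max_right _ _) hr
  -- the objects
  set k : ℤ := (r : ℤ) / 8 with hk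
  have hk8 : 8 ≤ k := by omega
  have hkr : 8 * k ≤ (r : ℤ) ∧ (r : ℤ) ≤ 8 * k + 7 := by omega
  set R : Set (Site 3) :=
    {x : Site 3 | -(r : ℤ) ≤ x 0 ∧ x 0 ≤ 2 * (r : ℤ) ∧ -(r : ℤ) ≤ x 1 ∧ x 1 ≤ 2 * (r : ℤ) ∧
      -(2 * (r : ℤ)) ≤ x 2 ∧ x 2 ≤ 3 * ((r : ℤ) / 8)} with hR_def
  set R' : Set (Site 3) :=
    {x : Site 3 | -(r : ℤ) - (2 * k - 1) ≤ x 0 ∧ x 0 ≤ 2 * (r : ℤ) + (2 * k - 1) ∧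
      -(r : ℤ) - (2 * k - 1) ≤ x 1 ∧ x 1 ≤ 2 * (r : ℤ) + (2 * k - 1) ∧
      -(2 * (r : ℤ)) - (2 * k - 1) ≤ x 2 ∧ x 2 ≤ 5 * k - 1} with hR'_def
  set W : Set (Site 3) := {x : Site 3 | (r : ℤ) - 3 * k ≤ x 2} with hW_def
  set s : ℕ := r / 16 - 1 with hs
  have hs_cast : (s : ℤ) = (r : ℤ) / 16 - 1 := by omega
  have hsk : 2 * (s : ℤ) ≤ k - 2 ∧ k - 3 ≤ 2 * (s : ℤ) := by omega
  have hs1 : 1 ≤ s := by omega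
  set g : ℤ := 2 * (s : ℤ) + 1 with hg
  have hgpos : 0 < g := by omega
  set anchor : Site 3 := ![4 * k, 4 * k, -(8 * k)] with hanchor
  have ha0 : anchor 0 = 4 * k := rfl
  have ha1 : anchor 1 = 4 * k := rfl
  have ha2 : anchor 2 = -(8 * k) := rfl
  set F : Site 3 → Site 3 := fun j i => anchor i + g * j i with hF
  set J : Finset (Site 3) := (box 3 25).image F with hJ_def
  have hJcard : J.card ≤ 51 ^ 3 :=
    le_trans Finset.card_image_le (by rw [card_box])
  -- membership unfolding
  have mem_R : ∀ u : Site 3, u ∈ R ↔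
      -(r : ℤ) ≤ u 0 ∧ u 0 ≤ 2 * (r : ℤ) ∧ -(r : ℤ) ≤ u 1 ∧ u 1 ≤ 2 * (r : ℤ) ∧
      -(2 * (r : ℤ)) ≤ u 2 ∧ u 2 ≤ 3 * ((r : ℤ) / 8) := fun u => Iff.rfl
  have mem_R' : ∀ u : Site 3, u ∈ R' ↔
      -(r : ℤ) - (2 * k - 1) ≤ u 0 ∧ u 0 ≤ 2 * (r : ℤ) + (2 * k - 1) ∧
      -(r : ℤ) - (2 * k - 1) ≤ u 1 ∧ u 1 ≤ 2 * (r : ℤ) + (2 * k - 1) ∧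
      -(2 * (r : ℤ)) - (2 * k - 1) ≤ u 2 ∧ u 2 ≤ 5 * k - 1 := fun u => Iff.rfl
  -- geometry
  have hRR' : R ⊆ R' := by
    intro u hu
    rw [mem_R] at hu
    rw [mem_R']
    omega
  have hN : ∀ x ∈ R, ∀ y, (zdGraph 3).Adj x y → y ∈ R' := by
    intro x hx y hxy
    rw [mem_R] at hx
    rw [mem_R']
    have h0 := zdGraph_adj_apply_le hxy 0
    have h1 := zdGraph_adj_apply_le hxy 1
    have h2 := zdGraph_adj_apply_le hxy 2
    omega
  have hWdisj : Disjoint R' W := by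
    rw [Set.disjoint_left]
    intro u hu huW
    rw [mem_R'] at hu
    simp only [hW_def, Set.mem_setOf_eq] at huW
    omega
  have hRW : R ⊆ {x : Site 3 | x 2 ≤ (r : ℤ) - ((r : ℤ) - 3 * k)} := by
    intro u hu
    rw [mem_R] at hu
    simp only [Set.mem_setOf_eq]
    omega
  -- the cover: every vertex adjacent to `R` lies in a tile of the grid whose doubled tile (plus one layer) is inside `R'`
  have hcover : ∀ u ∈ R' \ R, (∃ z ∈ R, (zdGraph 3).Adj u z) →
      ∃ v ∈ J, u - v ∈ box 3 s ∧
        ∀ y : Site 3, y - v ∈ box 3 (2 * s) → ∀ z : Site 3, (zdGraph 3).Adj y z → z ∈ R' := by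
    rintro u - ⟨z₀, hz₀, huz₀⟩
    rw [mem_R] at hz₀
    have hb0 := zdGraph_adj_apply_le huz₀ 0
    have hb1 := zdGraph_adj_apply_le huz₀ 1
    have hb2 := zdGraph_adj_apply_le huz₀ 2
    -- the tile index of `u`
    set q : Site 3 := fun i => (u i - anchor i + s) / g with hq
    have hdiv : ∀ i, (u i - anchor i + s) % g + g * q i = u i - anchor i + s ∧
        0 ≤ (u i - anchor i + s) % g ∧ (u i - anchor i + s) % g < g := fun i =>
      ⟨Int.emod_add_mul_ediv _ _, Int.emod_nonneg _ hgpos.ne', Int.emod_lt_of_pos _ hgpos⟩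
    -- a priori bounds on `u - anchor`
    have hlo : ∀ i, -(14 * k + 13) ≤ u i - anchor i ∧ u i - anchor i ≤ 14 * k + 13 := by
      intro i
      fin_cases i <;>
        simp only [ha0, ha1, ha2, Fin.zero_eta, Fin.mk_one, Fin.reduceFinMk, Fin.isValue] <;> omega
    refine ⟨F q, ?_, ?_, ?_⟩
    · -- `F q ∈ J`
      rw [hJ_def, Finset.mem_image]
      refine ⟨q, ?_, rfl⟩
      rw [mem_box]
      intro i
      obtain ⟨he, h0, h1⟩ := hdiv i
      obtain ⟨hl, hu⟩ := hlo i
      constructor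
      · by_contra hlt
        push Not at hlt
        have hm : g * q i ≤ g * (-26) := mul_le_mul_of_nonneg_left (by omega) hgpos.le
        generalize g * q i = X at he hm
        generalize (u i - anchor i + s) % g = Y at he h0 h1
        omega
      · by_contra hlt
        push Not at hlt
        have hm : g * 26 ≤ g * q i := mul_le_mul_of_nonneg_left (by omega) hgpos.le
        generalize g * q i = X at he hm
        generalize (u i - anchor i + s) % g = Y at he h0 h1
        omega
    · -- `u - F q ∈ B(s)`
      rw [mem_box]
      intro i
      obtain ⟨he, h0, h1⟩ := hdiv i
      change -(s : ℤ) ≤ u i - (anchor i + g * q i) ∧ u i - (anchor i + g * q i) ≤ (s : ℤ)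
      generalize g * q i = X at he ⊢
      generalize (u i - anchor i + s) % g = Y at he h0 h1
      omega
    · -- room: neighbours of `F q + B(2s)` lie in `R'`
      intro y hy z hyz
      rw [mem_box] at hy
      rw [mem_R']
      have hy0 := hy 0
      have hy1 := hy 1
      have hy2 := hy 2
      change -((2 * s : ℕ) : ℤ) ≤ y 0 - (anchor 0 + g * q 0) ∧ y 0 - (anchor 0 + g * q 0) ≤ ((2 * s : ℕ) : ℤ)
        at hy0
      change -((2 * s : ℕ) : ℤ) ≤ y 1 - (anchor 1 + g * q 1) ∧ y 1 - (anchor 1 + g * q 1) ≤ ((2 * s : ℕ) : ℤ)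
        at hy1
      change -((2 * s : ℕ) : ℤ) ≤ y 2 - (anchor 2 + g * q 2) ∧ y 2 - (anchor 2 + g * q 2) ≤ ((2 * s : ℕ) : ℤ)
        at hy2
      have hz0 := zdGraph_adj_apply_le hyz 0
      have hz1 := zdGraph_adj_apply_le hyz 1
      have hz2 := zdGraph_adj_apply_le hyz 2
      obtain ⟨he0, h00, h10⟩ := hdiv 0
      obtain ⟨he1, h01, h11⟩ := hdiv 1
      obtain ⟨he2, h02, h12⟩ := hdiv 2
      generalize g * q 0 = X0 at he0 hy0
      generalize g * q 1 = X1 at he1 hy1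
      generalize g * q 2 = X2 at he2 hy2
      generalize (u 0 - anchor 0 + s) % g = Y0 at he0 h00 h10
      generalize (u 1 - anchor 1 + s) % g = Y1 at he1 h01 h11
      generalize (u 2 - anchor 2 + s) % g = Y2 at he2 h02 h12
      push_cast at hy0 hy1 hy2
      omega
  -- T1: the tiled shell has probability ≥ cX ^ |J| ≥ cX ^ 51³
  have hT := stub_tiledShell (criticalProbI 3) s cX hcX.le (hX s hs1) R R' J hcover
  have hShell : cX ^ (51 ^ 3) ≤ (bondPercolation (zdGraph 3) (criticalProbI 3)).real
      {ω | ∀ u ∈ R' \ R, ∀ w ∈ R' \ R, (∃ z ∈ R, (zdGraph 3).Adj u z) →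
        (∃ z ∉ R', (zdGraph 3).Adj w z) → ω ∉ openConnIn (R' \ R) u w} :=
    le_trans (pow_le_pow_of_le_one hcX.le hcX1 hJcard) hT
  -- S1: decoupling
  have hdec := stub_shellDecoupling (zdGraph 3) (criticalProbI 3) hRR' hN hWdisj
    (0 : Site 3) ![(r : ℤ), (r : ℤ), 0] ![(r : ℤ), 0, (r : ℤ)] ![0, (r : ℤ), (r : ℤ)]
  -- S5' + S3: the two restricted connections
  have hA := hC r hr₁
  have hB : c * tau 3 (criticalProbI 3) 0 ![(r : ℤ), (r : ℤ), 0] ≤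
      (bondPercolation (zdGraph 3) (criticalProbI 3)).real
        (openConnIn W (![(r : ℤ), 0, (r : ℤ)] : Site 3) ![0, (r : ℤ), (r : ℤ)]) := by
    have hm := stub_mirrorRestrict (criticalProbI 3) r ((r : ℤ) - 3 * k)
    rw [hm]
    exact le_trans hA (measureReal_mono (openConnIn_mono hRW _ _))
  -- pair symmetry for τ
  obtain ⟨hτ, -⟩ := stub_pairSymm (criticalProbI 3) r
  have hτ' : tau 3 (criticalProbI 3) ![(r : ℤ), 0, (r : ℤ)] ![0, (r : ℤ), (r : ℤ)] =
      tau 3 (criticalProbI 3) 0 ![(r : ℤ), (r : ℤ), 0] := by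
    rw [tau_def, tau_def]; exact hτ
  rw [hτ']
  have hτnn : 0 ≤ tau 3 (criticalProbI 3) 0 ![(r : ℤ), (r : ℤ), 0] := tau_nonneg _ _ _
  have hcτ : 0 ≤ c * tau 3 (criticalProbI 3) 0 ![(r : ℤ), (r : ℤ), 0] := by positivity
  have hcXN : 0 ≤ cX ^ (51 ^ 3) := by positivity
  calc cX ^ (51 ^ 3) * c ^ 2 * tau 3 (criticalProbI 3) 0 ![(r : ℤ), (r : ℤ), 0] *
        tau 3 (criticalProbI 3) 0 ![(r : ℤ), (r : ℤ), 0]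
      = (c * tau 3 (criticalProbI 3) 0 ![(r : ℤ), (r : ℤ), 0]) * cX ^ (51 ^ 3) *
          (c * tau 3 (criticalProbI 3) 0 ![(r : ℤ), (r : ℤ), 0]) := by ring
    _ ≤ (bondPercolation (zdGraph 3) (criticalProbI 3)).real
            (openConnIn R (0 : Site 3) ![(r : ℤ), (r : ℤ), 0]) *
          (bondPercolation (zdGraph 3) (criticalProbI 3)).real
            {ω | ∀ u ∈ R' \ R, ∀ w ∈ R' \ R, (∃ z ∈ R, (zdGraph 3).Adj u z) →
              (∃ z ∉ R', (zdGraph 3).Adj w z) → ω ∉ openConnIn (R' \ R) u w} *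
          (bondPercolation (zdGraph 3) (criticalProbI 3)).real
            (openConnIn W (![(r : ℤ), 0, (r : ℤ)] : Site 3) ![0, (r : ℤ), (r : ℤ)]) := by
        refine mul_le_mul (mul_le_mul hA hShell hcXN measureReal_nonneg) hB hcτ
          (mul_nonneg measureReal_nonneg measureReal_nonneg)
    _ ≤ _ := hdec

/-- **X_B ∧ box restriction ⇒ `TetrahedronDisjointCoexistence`**, concluded by name (composition of line `Sketch`,
rev c2). -/
theorem tetrahedronDisjointCoexistence_of_annulusNonCrossing_of_boxRestriction
    (hXB : ∃ c : ℝ, 0 < c ∧ ∀ n : ℕ, 1 ≤ n →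
      (bondPercolation (zdGraph 3) (criticalProbI 3)).real
          {ω | ∃ x ∈ box 3 n, ∃ y ∈ innerBoundary (zdGraph 3) (box 3 (2 * n)),
            ω ∈ openConnIn ↑(box 3 (2 * n)) x y} ≤ 1 - c)
    (hBox : ∃ c : ℝ, 0 < c ∧ ∃ r₀ : ℕ, ∀ r : ℕ, r₀ ≤ r →
      c * tau 3 (criticalProbI 3) 0 ![(r : ℤ), (r : ℤ), 0] ≤
        (bondPercolation (zdGraph 3) (criticalProbI 3)).real
          (openConnIn
            {x : Site 3 | -(r : ℤ) ≤ x 0 ∧ x 0 ≤ 2 * (r : ℤ) ∧ -(r : ℤ) ≤ x 1 ∧ x 1 ≤ 2 * (r : ℤ) ∧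
              -(2 * (r : ℤ)) ≤ x 2 ∧ x 2 ≤ 3 * ((r : ℤ) / 8)}
            (0 : Site 3) ![(r : ℤ), (r : ℤ), 0])) :
    Theses.PercTreeValue.TetrahedronDisjointCoexistence := by
  unfold Theses.PercTreeValue.TetrahedronDisjointCoexistence
  exact stub_cruxOfTiledShell hXB hBox

/-- X_B together with box restriction settles the conjunct `θ(p_c(ℤ³)) = 0` (through the landed
`AssemblyViaDisjointCoexistence_proof`); X_B alone already does so through route `PercAnnulusCrossing` — this records that
the pair, hence the rev-c2 line's open content, is continuity-strength. -/
theorem percolationContinuityZ3_of_annulusNonCrossing_of_boxRestriction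
    (hXB : ∃ c : ℝ, 0 < c ∧ ∀ n : ℕ, 1 ≤ n →
      (bondPercolation (zdGraph 3) (criticalProbI 3)).real
          {ω | ∃ x ∈ box 3 n, ∃ y ∈ innerBoundary (zdGraph 3) (box 3 (2 * n)),
            ω ∈ openConnIn ↑(box 3 (2 * n)) x y} ≤ 1 - c)
    (hBox : ∃ c : ℝ, 0 < c ∧ ∃ r₀ : ℕ, ∀ r : ℕ, r₀ ≤ r →
      c * tau 3 (criticalProbI 3) 0 ![(r : ℤ), (r : ℤ), 0] ≤
        (bondPercolation (zdGraph 3) (criticalProbI 3)).real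
          (openConnIn
            {x : Site 3 | -(r : ℤ) ≤ x 0 ∧ x 0 ≤ 2 * (r : ℤ) ∧ -(r : ℤ) ≤ x 1 ∧ x 1 ≤ 2 * (r : ℤ) ∧
              -(2 * (r : ℤ)) ≤ x 2 ∧ x 2 ≤ 3 * ((r : ℤ) / 8)}
            (0 : Site 3) ![(r : ℤ), (r : ℤ), 0])) :
    _root_.PercolationContinuityZ3 := by
  have hA := AssemblyViaDisjointCoexistence_proof
  unfold Theses.PercTreeValue.AssemblyViaDisjointCoexistence at hA
  exact hA (tetrahedronDisjointCoexistence_of_annulusNonCrossing_of_boxRestriction hXB hBox)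

end Summit.CriticalPhenomena.PercolationContinuityZ3.Theorems.TetrahedronDisjointCoexistence

end
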